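import Summits.PneNP.PneNP.Theses.Circuit
import Literature.Computability.Complexity.StructuralPHProofs
import Literature.Computability.Complexity.KannanLanguageAE
import Literature.Computability.Complexity.CircuitSizeProofs

/-!
# `CircuitSuperlinear` (crux stmt-PneNP-0036, route `Circuit`): normal forms, load-bearing
# analysis of the hypothesis `L ∈ NP`, and the cost of a disproof (negative-side support,
# refuter cdisprove seat; nothing here asserts a Theses decl)

The crux is `X : ∃ L ∈ NP, ∀ c, ∃ᶠ n in atTop, c * n < Language.circuitSize L n` ("some NP language
has no `O(n)`-size `B₂`-circuits"). Recorded here, sorry-free: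

* `frequently_lt_circuitSize_iff_forall_not_mem_SIZE` — the matrix of X for one language is
  equivalent to `∀ c, L ∉ SIZE(c·n + c)` (absorb the finitely many small lengths into the
  constant); hence `circuitSuperlinear_iff_not_NP_subset` : `X ↔ ¬ (NP ⊆ ⋃ c, SIZE(c·n + c))`, the
  unrelativised instance of the shape of `Literature.Barriers.PneNP.RelativizedCircuitSize`
  (Wilson) / `Algebrization_npLinearSize` (Aaronson–Wigderson), and
  `circuitSuperlinear_iff_fixedPoly_one` : X is LITERALLY the `k = 1` instance of the route's
  support item `CircuitFixedPoly` (so that item implies X formally).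
* Load-bearing: the only hypothesis on the witness is `L ∈ NP` and it carries all the content —
  `exists_forall_eventually_lt_circuitSize` (dropping it, X holds almost everywhere at scale `n²`,
  witness Kannan's `Σ₄ᵖ` diagonal language) and `exists_mem_SigmaP_two_inter_PiP_two_superlinear`
  (replacing `NP` by `Σ₂ᵖ ∩ Π₂ᵖ ⊇ NP`, X is Kannan's theorem `kannan_holds 1`).
* Cost of a disproof: `NP_subset_PPoly_of_not_circuitSuperlinear` and
  `PH_eq_SigmaP_two_of_not_circuitSuperlinear` — `¬ X → NP ⊆ P/poly → PH = Σ₂ᵖ` (Karp–Lipton,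
  tree theorem `karp_lipton_holds`). No refutation of X is to be expected; the item stays open.
-/

set_option linter.dupNamespace false

namespace Summit.PneNP.PneNP.Theorems.CircuitSuperlinear.Negative

open Filter Literature.Computability.Complexity Literature.Computability.Complexity.Nondeterministic
open Summit.PneNP.PneNP.Theses.Circuit

/-! ### Normal forms -/

/-- An eventual linear bound on the circuit complexity upgrades to membership in a linear size
class `SIZE(c·n + c)` (absorb the finitely many exceptional lengths into the constant).
[folklore] -/
theorem exists_mem_SIZE_linear_of_eventually {L : Language Bool} {c₀ : ℕ}
    (h : ∀ᶠ n in atTop, L.circuitSize n ≤ c₀ * n) : ∃ c, L ∈ SIZE (fun n => c * n + c) := by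
  obtain ⟨N, hN⟩ := eventually_atTop.1 h
  set M := (Finset.range N).sup fun n => L.circuitSize n with hM
  refine ⟨c₀ + M, (mem_SIZE_iff_circuitSize_le_holds L _).2 fun n => ?_⟩
  by_cases hn : N ≤ n
  · calc L.circuitSize n ≤ c₀ * n := hN n hn
      _ ≤ (c₀ + M) * n := Nat.mul_le_mul_right n (Nat.le_add_right c₀ M)
      _ ≤ (c₀ + M) * n + (c₀ + M) := Nat.le_add_right _ _
  · have hle : L.circuitSize n ≤ M :=
      Finset.le_sup (f := fun n => L.circuitSize n) (Finset.mem_range.2 (not_le.1 hn))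
    calc L.circuitSize n ≤ M := hle
      _ ≤ c₀ + M := Nat.le_add_left M c₀
      _ ≤ (c₀ + M) * n + (c₀ + M) := Nat.le_add_left _ _

/-- **Normal form of the matrix of X.** "`c·n < circuitSize L n` infinitely often, for every `c`"
is the same as "`L` lies in no linear size class `SIZE(c·n + c)`" (all lengths, Arora–Barak
Def. 6.5 as in the tree's `SIZE`; the rendering `c * n + c` is the one of `kannan` and
`CircuitFixedPoly`). [folklore] -/
theorem frequently_lt_circuitSize_iff_forall_not_mem_SIZE (L : Language Bool) :
    (∀ c : ℕ, ∃ᶠ n in atTop, c * n < L.circuitSize n) ↔ ∀ c, L ∉ SIZE (fun n => c * n + c) := by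
  constructor
  · intro h c hc
    have hle := (mem_SIZE_iff_circuitSize_le_holds L _).1 hc
    obtain ⟨n, hlt, hn1⟩ := ((h (2 * c)).and_eventually (eventually_ge_atTop 1)).exists
    have h1 := hle n
    have h3 : c ≤ c * n := Nat.le_mul_of_pos_right c hn1
    have h4 : 2 * c * n = 2 * (c * n) := by ring
    omega
  · intro h c
    by_contra hc
    rw [Filter.not_frequently] at hc
    simp only [not_lt] at hc
    obtain ⟨c', hc'⟩ := exists_mem_SIZE_linear_of_eventually hc
    exact h c' hc'

/-- The same, as non-membership in the union of the linear size classes. [folklore] -/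
theorem frequently_lt_circuitSize_iff_not_mem_iUnion (L : Language Bool) :
    (∀ c : ℕ, ∃ᶠ n in atTop, c * n < L.circuitSize n) ↔ L ∉ ⋃ c : ℕ, SIZE (fun n => c * n + c) := by
  rw [frequently_lt_circuitSize_iff_forall_not_mem_SIZE, Set.mem_iUnion, not_exists]

/-- **X in class form**: `CircuitSuperlinear ↔ ¬ (NP ⊆ ⋃ c, SIZE (c·n + c))`. [folklore] -/
theorem circuitSuperlinear_iff_not_NP_subset :
    CircuitSuperlinear ↔ ¬ (NP ⊆ ⋃ c : ℕ, SIZE (fun n => c * n + c)) := by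
  rw [CircuitSuperlinear, Set.not_subset]
  simp only [frequently_lt_circuitSize_iff_not_mem_iUnion]

/-- **X is the `k = 1` instance of the route's support item `CircuitFixedPoly`**
(`∀ k, ∃ L ∈ NP, L ∉ ⋃ c, SIZE (c·nᵏ + c)`); in particular that item implies X formally.
[folklore] -/
theorem circuitSuperlinear_iff_fixedPoly_one :
    CircuitSuperlinear ↔ ∃ L ∈ NP, L ∉ ⋃ c : ℕ, SIZE (fun n => c * n ^ 1 + c) := by
  simp only [pow_one, CircuitSuperlinear, frequently_lt_circuitSize_iff_not_mem_iUnion]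

/-! ### Load-bearing analysis: the only hypothesis is `L ∈ NP` -/

/-- **Without `L ∈ NP`, X holds — even almost everywhere and at scale `n²`**: Kannan's diagonal
language `Kannan.lang 3 ∈ Σ₄ᵖ` has `n² < circuitSize _ n` for all large `n`
(`Kannan.eventually_pow_lt_circuitSize`). Any proof of X must therefore spend its effort on the
class of the witness, and any refutation must use `NP` (the bare existential is true).
[cite: Kannan1982, Lemma 1] -/
theorem exists_mem_SigmaP_four_forall_eventually_lt_circuitSize :
    ∃ L ∈ SigmaP 4, ∀ c : ℕ, ∀ᶠ n in atTop, c * n < L.circuitSize n := by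
  refine ⟨Kannan.lang 3, Kannan.lang_mem_SigmaP_four 3, fun c => ?_⟩
  filter_upwards [Kannan.eventually_pow_lt_circuitSize 2, eventually_ge_atTop c] with n hn hcn
  calc c * n ≤ n * n := Nat.mul_le_mul_right n hcn
    _ = n ^ 2 := (sq n).symm
    _ < _ := hn

/-- X with the hypothesis `L ∈ NP` dropped is a theorem. [cite: Kannan1982, Lemma 1] -/
theorem exists_forall_frequently_lt_circuitSize :
    ∃ L : Language Bool, ∀ c : ℕ, ∃ᶠ n in atTop, c * n < L.circuitSize n := by
  obtain ⟨L, -, hL⟩ := exists_mem_SigmaP_four_forall_eventually_lt_circuitSize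
  exact ⟨L, fun c => (hL c).frequently⟩

/-- **One level up, X is a theorem of the tree**: some `L ∈ Σ₂ᵖ ∩ Π₂ᵖ` satisfies the matrix of
X (Kannan 1982, Thm. 2 at `k = 1`, tree theorem `kannan_holds`), while `NP ⊆ Σ₂ᵖ ∩ Π₂ᵖ`
(`NP_subset_SigmaP_two_inter_PiP_two`). The whole content of X is lowering the witness from
`Σ₂ᵖ ∩ Π₂ᵖ` to `NP = Σ₁ᵖ`. [cite: Kannan1982, Thm. 2] -/
theorem exists_mem_SigmaP_two_inter_PiP_two_frequently_lt_circuitSize :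
    ∃ L ∈ SigmaP 2 ∩ PiP 2, ∀ c : ℕ, ∃ᶠ n in atTop, c * n < L.circuitSize n := by
  obtain ⟨L, hL, hLs⟩ := kannan_holds 1
  refine ⟨L, hL, (frequently_lt_circuitSize_iff_not_mem_iUnion L).2 ?_⟩
  simpa only [pow_one] using hLs

/-! ### What a disproof would cost -/

/-- `¬ X → NP ⊆ ⋃ c, SIZE(c·n + c) ⊆ P/poly`. [folklore] -/
theorem NP_subset_PPoly_of_not_circuitSuperlinear (h : ¬ CircuitSuperlinear) : NP ⊆ PPoly := by
  rw [circuitSuperlinear_iff_not_NP_subset, not_not] at h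
  refine h.trans (Set.iUnion_subset fun c =>
    SIZE_subset_PPoly (Polynomial.C c * Polynomial.X + Polynomial.C c) fun n => ?_)
  simp

/-- **`¬ X` collapses the polynomial hierarchy**: `¬ CircuitSuperlinear → PH = Σ₂ᵖ` (Karp–Lipton,
tree theorem `karp_lipton_holds`). An unconditional refutation of X would prove `PH = Σ₂ᵖ`.
[cite: KarpLipton1980] -/
theorem PH_eq_SigmaP_two_of_not_circuitSuperlinear (h : ¬ CircuitSuperlinear) : PH = SigmaP 2 :=
  karp_lipton_holds (NP_subset_PPoly_of_not_circuitSuperlinear h)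

end Summit.PneNP.PneNP.Theorems.CircuitSuperlinear.Negative
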